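import Summits.PneNP.PneNP.Theorems.ConvexRankGatesConvexGateBlindStubPerfectCompletenessHoneycomb

/-!
# The Tseitin contradiction on the honeycomb torus: isoperimetry, connectedness, unsatisfiability
(helper for stub `stub_perfectCompleteness` of line `xor-door-perfect-completeness`, crux `ConvexGateBlind`,
item stmt-PneNP-10680; registered sub-goal `stub_perfectCompleteness_honeycombIso`)

Continuation of `…StubPerfectCompletenessHoneycomb` (`n` even, `T : Finset (Fin n × Fin n)`,
`∂T = bd (hcA n) T`):

* ROWS BOUND (`card_partialRows_le`): a row meeting `T` in a proper non-empty subset carries a horizontal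
  boundary edge (discrete intermediate value on the cycle, `exists_step`), and distinct rows give
  distinct edges;
* COLUMNS BOUND (`le_two_mul_card_bd`): if a full row and an empty row coexist then every column pair
  `{j₀, j₀+1}` (`j₀` even) carries a boundary edge (the last row of the ladder meeting `T`: its used
  vertical edge, or the rung), so `n ≤ 2 #∂T`;
* hence the ISOPERIMETRIC INEQUALITY `honeycomb_iso` (`#∂T ≤ d'`, `2d' < n` ⟹ `#T ≤ d' n` or
  `n² ≤ #T + d' n`) and CONNECTEDNESS `honeycomb_conn` (`∂T = ∅ ⟹ T = ∅ ∨ T = univ`);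
* UNSATISFIABILITY `honeycomb_unsat`: every variable lies in an even number of equations
  (`bd_univ`) while the total charge is `1`.
-/

set_option linter.dupNamespace false -- `Summit.PneNP.PneNP.…`: summit = sub-problem (D-0017)

namespace Summit.PneNP.PneNP.Theorems.XorDoor.PC

open Finset

noncomputable section

section HoneycombIso

variable {n : ℕ} [NeZero n]
/-! ### Discrete intermediate value on the cycle -/

/-- On the cycle `Fin n`: if `P a` and `¬ P b` then `P i ∧ ¬ P (i + 1)` for some `i`. [folklore] -/
theorem exists_step {P : Fin n → Prop} {a b : Fin n} (ha : P a) (hb : ¬ P b) :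
    ∃ i, P i ∧ ¬ P (i + 1) := by
  by_contra hcon
  push Not at hcon
  obtain ⟨k, rfl⟩ : ∃ k, n = k + 1 := Nat.exists_eq_succ_of_ne_zero (NeZero.ne n)
  have hall : ∀ j : Fin (k + 1), P (a + j) := by
    intro j
    induction j using Fin.induction with
    | zero => simpa using ha
    | succ i ih =>
        rw [← Fin.coeSucc_eq_succ, ← add_assoc]
        exact hcon _ ih
  apply hb
  have h := hall (b - a)
  rwa [add_sub_cancel] at h

/-! ### Partial rows -/

/-- A row that is neither full nor empty has a horizontal boundary edge. [folklore] -/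
theorem exists_hE_mem_bd (hn : Even n) {T : Finset (Fin n × Fin n)} {i : Fin n}
    (h1 : ¬ ∀ j, (i, j) ∈ T) (h2 : ¬ ∀ j, (i, j) ∉ T) : ∃ j, hE n (i, j) ∈ bd (hcA n) T := by
  push Not at h1 h2
  obtain ⟨j₁, hj₁⟩ := h1
  obtain ⟨j₀, hj₀⟩ := h2
  obtain ⟨j, hj, hj'⟩ := exists_step (P := fun j => (i, j) ∈ T) hj₀ hj₁
  exact ⟨j, (hE_mem_bd hn T i j).2 (iff_of_true hj hj')⟩

/-- The rows meeting `T` in a proper non-empty subset. [folklore] -/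
def partialRows (T : Finset (Fin n × Fin n)) : Finset (Fin n) :=
  univ.filter fun i => (¬ ∀ j, (i, j) ∈ T) ∧ ¬ ∀ j, (i, j) ∉ T

omit [NeZero n] in
/-- Membership in `partialRows`. [folklore] -/
theorem mem_partialRows {T : Finset (Fin n × Fin n)} {i : Fin n} :
    i ∈ partialRows T ↔ (¬ ∀ j, (i, j) ∈ T) ∧ ¬ ∀ j, (i, j) ∉ T := by
  simp [partialRows]

/-- **Rows bound**: distinct partial rows give distinct horizontal boundary edges. [folklore] -/
theorem card_partialRows_le (hn : Even n) (T : Finset (Fin n × Fin n)) :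
    (partialRows T).card ≤ (bd (hcA n) T).card := by
  have hex : ∀ i ∈ partialRows T, ∃ j, hE n (i, j) ∈ bd (hcA n) T := fun i hi => by
    rw [mem_partialRows] at hi
    exact exists_hE_mem_bd hn hi.1 hi.2
  choose! jf hjf using hex
  refine card_le_card_of_injOn (fun i => hE n (i, jf i)) (fun i hi => hjf i hi) ?_
  intro i _ i' _ h
  have h' := hE_inj.1 h
  simp only [Prod.mk.injEq] at h'
  exact h'.1

/-! ### Column pairs -/

/-- **Columns bound, one pair.** If some row is full and some row is empty then each column pair
`{j₀, j₀ + 1}` (`j₀` even) carries a boundary edge: a used vertical edge in one of the two columns or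
the rung `hE (i, j₀)`. [folklore] -/
theorem exists_mem_bd_colOf (hn : Even n) {T : Finset (Fin n × Fin n)} {r₁ r₀ : Fin n}
    (h₁ : ∀ j, (r₁, j) ∈ T) (h₀ : ∀ j, (r₀, j) ∉ T) {j₀ : Fin n} (hj₀ : par n j₀ = 0) :
    ∃ x ∈ bd (hcA n) T, colOf n x = j₀ ∨ colOf n x = j₀ + 1 := by
  obtain ⟨i, hi, hi'⟩ := exists_step (P := fun i => (i, j₀) ∈ T ∨ (i, j₀ + 1) ∈ T)
    (Or.inl (h₁ j₀)) (not_or.2 ⟨h₀ j₀, h₀ (j₀ + 1)⟩)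
  simp only [not_or] at hi'
  by_cases hpi : par n i = 0
  · -- the used vertical slot from row `i` is in column `j₀`
    have hpar : par n i + par n j₀ = 0 := by rw [hpi, hj₀, add_zero]
    by_cases hmem : (i, j₀) ∈ T
    · exact ⟨vE n (i, j₀), (vE_mem_bd hn T hpar).2 (iff_of_true hmem hi'.1), Or.inl (colOf_vE _)⟩
    · refine ⟨hE n (i, j₀), (hE_mem_bd hn T i j₀).2 ?_, Or.inl (colOf_hE _)⟩
      exact iff_of_false hmem (not_not.2 (hi.resolve_left hmem))
  · -- the used vertical slot from row `i` is in column `j₀ + 1`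
    have hpar : par n i + par n (j₀ + 1) = 0 := by
      rw [par_add_one hn, hj₀, zero_add, (eq_zero_or_eq_one _).resolve_left hpi,
        one_add_one_eq_zero]
    by_cases hmem : (i, j₀ + 1) ∈ T
    · exact ⟨vE n (i, j₀ + 1), (vE_mem_bd hn T hpar).2 (iff_of_true hmem hi'.2),
        Or.inr (colOf_vE _)⟩
    · refine ⟨hE n (i, j₀), (hE_mem_bd hn T i j₀).2 ?_, Or.inl (colOf_hE _)⟩
      exact iff_of_true (hi.resolve_right hmem) hmem

/-- **Columns bound.** If some row is full and some row is empty then `n ≤ 2 #∂T`. [folklore] -/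
theorem le_two_mul_card_bd (hn : Even n) {T : Finset (Fin n × Fin n)} {r₁ r₀ : Fin n}
    (h₁ : ∀ j, (r₁, j) ∈ T) (h₀ : ∀ j, (r₀, j) ∉ T) : n ≤ 2 * (bd (hcA n) T).card := by
  set EC : Finset (Fin n) := univ.filter fun j => par n j = 0 with hEC
  set OC : Finset (Fin n) := univ.filter fun j => ¬ par n j = 0 with hOC
  have hsum : EC.card + OC.card = n := by
    rw [hEC, hOC, Finset.card_filter_add_card_filter_not, card_univ, Fintype.card_fin]
  have h1 : EC.card ≤ OC.card := by
    refine card_le_card_of_injOn (· + 1) (fun j hj => ?_) fun a _ b _ h => add_right_cancel h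
    rw [mem_coe, mem_filter] at hj ⊢
    rw [par_add_one hn, hj.2, zero_add]
    exact ⟨mem_univ _, one_ne_zero⟩
  have h2 : OC.card ≤ EC.card := by
    refine card_le_card_of_injOn (· + 1) (fun j hj => ?_) fun a _ b _ h => add_right_cancel h
    rw [mem_coe, mem_filter] at hj ⊢
    rw [par_add_one hn, (eq_zero_or_eq_one _).resolve_left hj.2, one_add_one_eq_zero]
    exact ⟨mem_univ _, rfl⟩
  have hex : ∀ j ∈ EC, ∃ x ∈ bd (hcA n) T, colOf n x = j ∨ colOf n x = j + 1 := fun j hj =>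
    exists_mem_bd_colOf hn h₁ h₀ (mem_filter.1 hj).2
  choose! g hg hgc using hex
  have h3 : EC.card ≤ (bd (hcA n) T).card := by
    refine card_le_card_of_injOn g (fun j hj => hg j hj) ?_
    intro a ha b hb hab
    have hca := hgc a ha
    have hcb := hgc b hb
    rw [hab] at hca
    rw [mem_coe, mem_filter] at ha hb
    have hpa : par n (a + 1) ≠ 0 := by rw [par_add_one hn, ha.2, zero_add]; exact one_ne_zero
    have hpb : par n (b + 1) ≠ 0 := by rw [par_add_one hn, hb.2, zero_add]; exact one_ne_zero
    rcases hca with hca | hca <;> rcases hcb with hcb | hcb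
    · exact hca.symm.trans hcb
    · exact absurd ha.2 (hca.symm.trans hcb ▸ hpb)
    · exact absurd hb.2 (hcb.symm.trans hca ▸ hpa)
    · exact add_right_cancel (hca.symm.trans hcb)
  omega

/-! ### Isoperimetry and connectedness -/

/-- **Isoperimetric inequality of the honeycomb torus.** If `#∂T ≤ d'` with `2d' < n` then `T` has at
most `d' n` vertices or misses at most `d' n` vertices (rows bound: at most `d'` partial rows;
columns bound: full and empty rows cannot coexist). [folklore] -/
theorem honeycomb_iso (hn : Even n) (T : Finset (Fin n × Fin n)) {d' : ℕ}
    (hbd : (bd (hcA n) T).card ≤ d') (hd : 2 * d' < n) :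
    T.card ≤ d' * n ∨ n * n ≤ T.card + d' * n := by
  have hP := card_partialRows_le hn T
  have key : (∀ i, ¬ ∀ j, (i, j) ∈ T) ∨ (∀ i, ¬ ∀ j, (i, j) ∉ T) := by
    by_contra hcon
    push Not at hcon
    obtain ⟨⟨r₁, h₁⟩, ⟨r₀, h₀⟩⟩ := hcon
    have := le_two_mul_card_bd hn h₁ h₀
    omega
  have hprod : (partialRows T ×ˢ (univ : Finset (Fin n))).card ≤ d' * n := by
    rw [card_product, card_univ, Fintype.card_fin]
    exact Nat.mul_le_mul_right n (hP.trans hbd)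
  rcases key with hnf | hne
  · left
    have hsub : T ⊆ partialRows T ×ˢ univ := by
      rintro ⟨i, j⟩ hij
      rw [mem_product, mem_partialRows]
      exact ⟨⟨hnf i, fun h => h j hij⟩, mem_univ _⟩
    exact (card_le_card hsub).trans hprod
  · right
    have hsub : Tᶜ ⊆ partialRows T ×ˢ univ := by
      rintro ⟨i, j⟩ hij
      rw [mem_compl] at hij
      rw [mem_product, mem_partialRows]
      exact ⟨⟨fun h => hij (h j), hne i⟩, mem_univ _⟩
    have h1 := (card_le_card hsub).trans hprod
    rw [card_compl, Fintype.card_prod, Fintype.card_fin] at h1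
    omega

/-- **Connectedness of the honeycomb torus**: only `∅` and `univ` have empty boundary. [folklore] -/
theorem honeycomb_conn (hn : Even n) (T : Finset (Fin n × Fin n)) (h0 : bd (hcA n) T = ∅) :
    T = ∅ ∨ T = univ := by
  have hnp : ∀ i, (∀ j, (i, j) ∈ T) ∨ (∀ j, (i, j) ∉ T) := by
    intro i
    by_contra hcon
    rw [not_or] at hcon
    obtain ⟨j, hj⟩ := exists_hE_mem_bd hn hcon.1 hcon.2
    rw [h0] at hj
    exact notMem_empty _ hj
  have h2 := two_le hn
  by_cases hfull : ∃ i, ∀ j, (i, j) ∈ T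
  · obtain ⟨r₁, h₁⟩ := hfull
    right
    rw [eq_univ_iff_forall]
    rintro ⟨i, j⟩
    rcases hnp i with h | h
    · exact h j
    · exfalso
      have h3 := le_two_mul_card_bd hn h₁ h
      rw [h0, card_empty] at h3
      omega
  · left
    push Not at hfull
    rw [eq_empty_iff_forall_notMem]
    rintro ⟨i, j⟩
    rcases hnp i with h | h
    · obtain ⟨j', hj'⟩ := hfull i
      exact absurd (h j') hj'
    · exact h j

/-! ### Unsatisfiability -/

/-- Every variable lies in an even number of equations: `∂ univ = ∅`. [folklore] -/
theorem bd_univ (hn : Even n) : bd (hcA n) (univ : Finset (Fin n × Fin n)) = ∅ := by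
  rw [eq_empty_iff_forall_notMem]
  intro x hx
  obtain ⟨s, rfl⟩ := (enc n).surjective x
  rcases s with ⟨i, j⟩ | ⟨i, j⟩
  · have h := (hE_mem_bd hn univ i j).1 hx
    simp at h
  · by_cases hij : par n i + par n j = 0
    · have h := (vE_mem_bd hn univ hij).1 hx
      simp at h
    · exact vE_not_mem_bd hn univ hij hx

/-- The two horizontal variables of a vertex differ. [folklore] -/
theorem hE_ne_hL (hn : Even n) (v : Fin n × Fin n) : hE n v ≠ hL n v := by
  unfold hL
  rw [Ne, hE_inj]
  obtain ⟨i, j⟩ := v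
  simp only [Prod.mk.injEq, true_and]
  intro h
  exact ne_add_one hn (j - 1) (by rw [sub_add_cancel]; exact h.symm)

/-- The right horizontal and the vertical variable of a vertex differ. [folklore] -/
theorem hE_ne_vert (v : Fin n × Fin n) : hE n v ≠ vert n v := by
  rw [vert_eq]
  exact hE_ne_vE _ _

/-- The left horizontal and the vertical variable of a vertex differ. [folklore] -/
theorem hL_ne_vert (v : Fin n × Fin n) : hL n v ≠ vert n v := by
  unfold hL
  rw [vert_eq]
  exact hE_ne_vE _ _

/-- The equation of a vertex reads `y (hE v) + y (hL v) + y (vert v) = c v`. [folklore] -/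
theorem sum_hcA (hn : Even n) (v : Fin n × Fin n) (y : Fin (n * n + n * n) → ZMod 2) :
    ∑ x ∈ hcA n v, y x = y (hE n v) + y (hL n v) + y (vert n v) := by
  unfold hcA
  rw [sum_insert, sum_insert, sum_singleton, add_assoc]
  · simpa using hL_ne_vert v
  · simp [hE_ne_hL hn v, hE_ne_vert v]

/-- The character of the three variables of a vertex is the sign of its equation's left side:
`χ_{A v}(y) = sgn (y (hE v) + y (hL v) + y (vert v))`. [folklore] -/
theorem chi_hcA (hn : Even n) (v : Fin n × Fin n) (y : Fin (n * n + n * n) → ZMod 2) :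
    chi (hcA n v) y = sgn (y (hE n v) + y (hL n v) + y (vert n v)) := by
  unfold chi hcA
  rw [prod_insert, prod_insert, prod_singleton, sgn_add, sgn_add, mul_assoc]
  · simpa using hL_ne_vert v
  · simp [hE_ne_hL hn v, hE_ne_vert v]

/-- **The honeycomb Tseitin system is unsatisfiable**: summing all equations, every variable occurs
an even number of times while the total charge is `1`. [folklore] -/
theorem honeycomb_unsat (hn : Even n) :
    ¬ ∃ y : Fin (n * n + n * n) → ZMod 2, ∀ v, y (hE n v) + y (hL n v) + y (vert n v) = hcC n v := by
  rintro ⟨y, hy⟩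
  have hsum : ∑ v, ∑ x ∈ hcA n v, y x = ∑ v, hcC n v :=
    sum_congr rfl fun v _ => by rw [sum_hcA hn, hy]
  have hrhs : ∑ v, hcC n v = 1 := by
    simp only [hcC]
    rw [Finset.sum_ite_eq' univ ((0 : Fin n), (0 : Fin n))]
    simp
  have hlhs : ∑ v, ∑ x ∈ hcA n v, y x = 0 := by
    calc ∑ v, ∑ x ∈ hcA n v, y x = ∑ v, ∑ x, if x ∈ hcA n v then y x else 0 := by
          refine sum_congr rfl fun v _ => ?_
          rw [sum_ite_mem, univ_inter]
      _ = ∑ x, ∑ v, if x ∈ hcA n v then y x else 0 := sum_comm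
      _ = ∑ x, y x * bsum (hcA n) univ x := by
          refine sum_congr rfl fun x _ => ?_
          rw [bsum, mul_sum]
          refine sum_congr rfl fun v _ => ?_
          split_ifs <;> simp
      _ = 0 := sum_eq_zero fun x _ => by
          have hx : x ∉ bd (hcA n) univ := by
            rw [bd_univ hn]
            exact notMem_empty _
          rw [mem_bd] at hx
          rw [(eq_zero_or_eq_one _).resolve_right hx, mul_zero]
  rw [hlhs, hrhs] at hsum
  exact zero_ne_one hsum
end HoneycombIso

/-- Registered sub-goal `stub_perfectCompleteness_honeycombIso` of stub `stub_perfectCompleteness`: the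
isoperimetric inequality of the honeycomb torus. [folklore] -/
theorem stub_perfectCompleteness_honeycombIso : ∀ {n : ℕ} [NeZero n], Even n →
    ∀ (T : Finset (Fin n × Fin n)) {d' : ℕ}, (bd (hcA n) T).card ≤ d' → 2 * d' < n →
    T.card ≤ d' * n ∨ n * n ≤ T.card + d' * n :=
  fun hn T _ hbd hd => honeycomb_iso hn T hbd hd

end

end Summit.PneNP.PneNP.Theorems.XorDoor.PC
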